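import Mathlib
import HarnessLib
import HarnessLib.Audit
import Summits.Ventures.CertifiedManyBodySolver.Downfold.BoxesHg1201EKinematicCoverNM19
import Summits.Ventures.CertifiedManyBodySolver.Downfold.BoxesHg1201EKinematicSlabTp
import Summits.Ventures.CertifiedManyBodySolver.Observables.StiffnessApexTransportCurtainTargetSlot

/-!
Route: CovHg1201M19

DORMANT since 2026-09-03T05:49:51Z (reconciler: no traction for 5 d (last activity item-evidence-added at 2026-08-29T05:00:41Z); parked, not closed — `ledger route dormant route-Ventures-CovHg1201M19 --off` to reactivate) — unstaffed, not closed; items shared with open routes are served there. `ledger route dormant <id> --off` reactivates.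

# Route CovHg1201M19 — hubbard-cov-hg1201-M19 — certified T = 0 flux-stiffness ceiling below 0.98 ×
kinematic on the Hg-1201 optimal-doping box (M19, p = 0.16, @0), owed on the halved corner strip,
from the two «L» bundles

It suffices to show X = PatchLeftEdgeM19 ∧ PatchBottomM19: on the downfolded one-band box of
HgBa₂CuO₄₊δ at OPTIMAL doping (VSET M19, p = 0.16, P = 0;
`boxHg1201E_M19` = U/t ∈ [7/2, 44/5] × t′/t ∈ [−27/50, −43/100] × n ∈ [4/5, 22/25]) the certified
CEILING c = 0.5084577 (= 0.98 × the box kinematic word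
0.5188344, rounded down, `boxHg1201E_M19_stiffness_kinematic`) on the thermodynamic-limit
uniform-flux stiffness is OWED ONLY on the HALVED RESIDUAL CORNER
STRIP R‴ = t′ ∈ [−27/50, −53/100] × U ∈ [7/2, 44/5] × n ∈ [43/50, 22/25] (1/44 of the (t′, n) face;
the rest is node-free kinematics PROVED in the tree:
densities n ≤ 43/50 and slots ≥ −13/25 by box-2 g1 `Hg1201M19_StiffnessBoxCeiling_of_cornerStrip`
p630377 (M = 512 row (−27/50, 4077/8192), margin
+0.0006403), slots t′ ≥ −53/100 by unc-3 g5 `hg1201M19_bar_kinematic_of_m53o100_le_tp` (M = 512 row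
(−53/100, 3823/8192), reading 0.5064221 at 22/25,
margin +0.0020356)), and R‴ is discharged lever-free by the «L»: the LEFT-EDGE bundle (certified
ceilings ⟨X₀(σ, U')⟩ ≤ c on torus-limit sector ground
states at (−27/50, U', n), U' ∈ [7/2, 44/5]) and the BOTTOM bundle (the same for ⟨X₀(σ, 7/2)⟩ at (s,
7/2, n), s ∈ [−27/50, σ]) over target slots
σ ∈ [−27/50, −53/100], transported to every point of R‴ by the target-slot theorem
`ObsStiffnessSeqCeilingAt_on_box_of_bottomEdge_and_leftEdge_targetSlot`
(no source outside the box, no K₂ input). The pair gives the rung leaf «MOS2-hg1201-M19»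
`Hg1201M19_StiffnessBoxCeiling`. This is the THIRD sibling of
routes CovHg1201M19b (@0, p = 0.125, OPEN) and CovHg1201M19P10 (@10, DRAFT) — same mechanism, same
instrument, third parameter column; the columns are
certified SEPARATELY and nothing is inferred from their differences (no doping-trend, phase or T_c
sentence; CONTROL / CALIBRATION ceilings + labelled
heuristic only). Its deciding corner word is ALREADY PRINTED: w′(7/2) = 0.4950122 ≤ 0.5084577 at
(−27/50, 7/2, 22/25) (hubbard-cov-hg1201-sdp-2 «A′7o2»
kit j305091, 2026-08-28T11:47Z, margin 0.0134455 = ZONE (i′)), and w′(5) = 0.4885510 (j305093,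
margin 0.0199067).
Lean: `Summit.Ventures.CertifiedManyBodySolver.Theses.CovHg1201M19.PatchLeftEdgeM19 ∧
Summit.Ventures.CertifiedManyBodySolver.Theses.CovHg1201M19.PatchBottomM19`

## Assembly
The tree's lever-free target-slot «L» theorem turns the two bundles (values := −c, prices trivial)
into the cell leaf on R‴
`∀ tp ∈ [−27/50, −53/100], ∀ U ∈ [7/2, 44/5], ∀ n ∈ [43/50, 22/25], ObsStiffnessSeqCeilingAt tp U n
c` with c = 5084577/10⁷; the t′-cut
`hg1201M19_bar_kinematic_of_m53o100_le_tp` (unc-3 g5, `Downfold/BoxesHg1201EKinematicSlabTp.lean`)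
extends it to t′ ∈ [−27/50, −13/25], and
`Hg1201M19_StiffnessBoxCeiling_of_cornerStrip le_rfl` (box-2 g1 p630377: the complement of the strip
is node-free kinematics below the bar) concludes the
registered leaf. The deciding theorem is `closes` in glue.lean (elaborates: Sketch.lean `lean check`
rc 0, 0 sorry, 2026-08-28T12:0xZ; the same proof is
`strip_of_bundles` + `fullStrip_of_bundles` + `closes` there).

CLOSES_TARGET: closes rung MO-S2 of Ventures/CertifiedManyBodySolver: Summit.Ventures.CertifiedManyBodySolver.Observables.Hg1201M19_StiffnessBoxCeiling (D-0061; not the summit Statement) — the deciding theorem of this route concludes that registered leaf (Ventures/CertifiedManyBodySolver: no summit Statement) (class rung: servable and labelled, never counted as concluding the summit Statement).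

Rationale: WHY THIS LINE. The mechanism is the f-sum (odd-moment) CEILING on the flux stiffness (Kohn1964;
ScalapinoWhiteZhang1993 §II; Lipparini2008 eq. (8.30);
HazraVermaRanderia2019 eqs. (2)–(6)): ρ_s ≤ ⟨X₀(t′, U)⟩, the kinetic combination, whose
thermodynamic-limit ground-state expectation at a TARGET
(t′, U) is bounded through the Hellmann–Feynman orbit by certified expectations of the target-slot
objective −X₀(σ, ·) at SOURCE points on the
left edge (t′ = −27/50) and the bottom (U = 7/2) of the strip
(`ObsStiffnessSeqCeilingAt_on_box_of_bottomEdge_and_leftEdge_targetSlot`, in tree,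
lever-free), each source certified by exact rational SDP dual rows on torus-limit RDM relaxations
(claim nodes) and read over the density interval
[43/50, 22/25] by the families' own Wang–Nishida filling multipliers
(`SquareTTPrimeBundleOrbitLowerRowWN`, box-1 g1 p625626, the M19b closers
p626127 are the template with 183/200 ↦ 22/25) and over U / t′ cells by PINNED two-vertex pairs
(captain rulings C-S1 / C-S1′, algo-p2 PINNED-SPOKES-RUNBOOK).
Imported from many-body sum-rule theory and convex optimisation (arXiv:2310.05844); nothing
probabilistic. What it does that the sibling routes do not:
it registers the OPTIMAL-DOPING column of the same compound, whose kinematic cover is complete in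
the tree TODAY at M = 512 in both directions (so the
items are born on 1/44 of the face, not 1/22), and whose deciding corner word is printed BEFORE
birth: c/K′ = 0.9694 at (−27/50, 7/2, 22/25)
(K′ = 0.51066 [float], needed ≤ 0.9957), coupling content K′ − w′ = 0.0157 — the same 2.6 % bite the
instrument showed on the p = 0.125 column
(c/K = 0.9707, «A7o2» j300184) — so the route's entire content is the «L» transport over a U-span of
5.3 and a t′-span of 1/100 with margins of record
0.0134 / 0.0199 at the two printed vertices (captain HG1201-COVERAGE-PLAN v0.4, decision node D1′ =
ZONE (i′)).

RANKED CRUXES. #2 PatchLeftEdgeM19 (crux) — «PatchLeftEdgeM19» = the LEFT-EDGE BUNDLE of R‴: for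
every density n ∈ [43/50, 22/25], slot σ ∈ [−27/50, −53/100] and station U' ∈ [7/2, 44/5], every
torus-limit sector ground state at the Hamiltonian point (t′, U, n) = (−27/50, U', n) has
D₄-averaged expectation of the target-slot f-sum objective −X₀(σ, U') at least −0.5084577, i.e. the
certified ceiling ⟨X₀(σ, U')⟩ ≤ 0.98 × the box kinematic word (own-slot corner words w′(U') = the
case σ = −27/50; intended witness: own-slot reads at vertices U' ∈ {7/2, 5, 44/5} on the EXT5-L⁺
parents «GU7o2n22o25tpm27o50» / «GU5…» / «GU44o5…» (gen-1 W3 set, all deposited; A′7o2 j305091 =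
0.4950122 and A′5 j305093 = 0.4885510 PRINTED, A′44o5 j305094 in flight) + PINNED-pair U-cell reads
(hub = free certificate at the small-margin end, spoke = pinned solve at the other end, captain
ruling C-S1′; ONE bisection per failed cell per the measured spacing law L ∝ ΔU^1.4), density
interval [43/50, 22/25] by the families' own filling multipliers (WN rows, zero extra solves);
reader owner hubbard-cov-hg1201-box-1 lineage). [difficulty: L] (why it might fail: instrumental — a
pinned U-cell read's le cross term exceeds the triangle allowance (√m_hub + √m_spoke)² at every
affordable spacing (free le at ΔU = 3/2 on the p = 0.125 column: 0.101 vs 0.065), forcing bisections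
the XL queue cannot carry; the corner itself is printed (margin 0.0134).) [HazraVermaRanderia2019,
ScalapinoWhiteZhang1993, arXiv:2205.12325, arXiv:2310.05844, KomaTasaki1994]
#3 PatchBottomM19 (crux) — «PatchBottomM19» = the BOTTOM BUNDLE of R‴: for every n ∈ [43/50, 22/25],
slot σ ∈ [−27/50, −53/100] and source s ∈ [−27/50, σ], every torus-limit sector ground state at (s,
7/2, n) has D₄-averaged expectation of −X₀(σ, 7/2) at least −0.5084577 (σ-span 1/100 after the
t′-kinematic cut; vertices = the corner parent shared with PatchLeftEdgeM19 + ONE spoke at (7/2,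
−53/100, 22/25) or (7/2, −13/25, 22/25) pinned to the corner certificate (t′-pinned pair, R = 2 856
axis-dependent eom rows; free le part at Δt′ = 1/50 on the p = 0.125 column = 0.0021), read on the
sub-cell; at the inner edge s = −53/100 nothing is owed (all slots σ ≥ −53/100 are state-free)).
[difficulty: M] (why it might fail: only through its s = −27/50 end, which IS PatchLeftEdgeM19's
corner word (printed, margin 0.0134); independently only if the t′-pinned pair's pinning price π
exceeds ≈ 0.015 at Δt′ ≤ 1/50 (La214's first two pinned solves: π = 0.0003 / 0.0005 at Δt′ = 0.1).)
[HazraVermaRanderia2019, arXiv:2310.05844, KomaTasaki1994]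

TWO-LAYER PLAN. Foreseen glued splits (nothing filed now): PatchLeftEdgeM19 ⇐ LeftEdgeLowUM19 (U' ∈
[7/2, 5]) → LeftEdgeHighUM19 (U' ∈ [5, 44/5]) → PatchLeftEdgeM19
(glue = interval union `covHg1201M19b_leftEdgeStrip_union/_of_chain` template, p626127; only if a
pinned U-cell read FAILS its triangle allowance,
captain ruling C-S1/C-S1′: ONE bisection station per failed cell, never a pre-emptive ladder — the p
= 0.125 column's level-1 parents at U = 17/4 and 7
exist at n = 183/200 and are one GENONLY run away at n = 22/25); the density direction is carried
EXACTLY by the WN filling rows of each pinned family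
(box-1 g1 node shape `SquareTTPrimeBundleOrbitLowerRowWN`, calibrated on the p = 0.125 column: fresh
solve at 179/200 = 0.4987778 vs transported
≤ 0.4995917); PatchBottomM19 ⇐ ONE pinned sub-cell read on [−27/50, −53/100] (fallback: a FREE
two-vertex read with a vertex at −53/100, L ≈ 0.04 [HEUR]).

KILL CRITERIA. ROUTE-KILL witness (referee wording of the M19b sibling, ADOPTED): a certified
torus-limit ground-state FLOOR on ⟨X₀(−27/50, U')⟩ (or on a target-slot
objective of the «L») ABOVE 0.5084577 at a point of R‴ — then no f-sum / orbit-lower edition can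
close there and the line as drawn is dead (pivot =
a director bar, or a content rung keyed to 0.98 × V per corner typed BESIDE the leaf) — NOT expected
(the corner ceiling is printed at 0.4950122 and truth
there ≈ 0.44–0.49 [EST]). ITEM REFUTATION of PatchLeftEdgeM19 / PatchBottomM19 as typed = such a
floor on the f-sum objective's expectation (a certified
kinetic-combination LOWER bound at a doped frustrated point — no instrument of record produces one
at the needed precision); a flux-STIFFNESS floor above
the bar would refute the leaf itself and is not producible at all
(StiffnessFloorInvisibleToSpectralMoments). The REALISTIC failure is INSTRUMENTAL: the
pinned U-cell reads between the printed vertices do not close at affordable spacing ⇒ the leaf stays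
OPEN, the vertex words are banked as CONTROL rows
(A′7o2 / A′5 bookable today), nothing moves; a proved PatchBottomM19 with PatchLeftEdgeM19 open
moots nothing (banked as the bottom-bundle word).

NOT DECOMPOSED YET. The third vertex (A′44o5 kit j305094, cap −113/200 by value, in flight), the
caps at n = 22/25 (box-1 `hfCap_hg1201top_m540_n088_point` BY NAME; a-priori
floor `hg1201_M19b_apriori_kinFloor_tpm27o50`), the pinned-pair U-cell reads and their spacing
(decided on the p = 0.125 column's PIN-HG-U / PIN-HG-U′
verdicts of 2026-08-28 ≈ 12:45Z, same law), the t′-pinned bottom pair, the WN closers with 183/200 ↦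
22/25 and 179/200 ↦ 43/50, and the exact rational
certificate format are layer-2 / producer business (seats `hubbard-cov-hg1201-gen-1`, `-box-1…2`,
`-sdp-1…2`, referee `-ref-1`, captain `-plan-1`
HG1201-COVERAGE-PLAN v0.4); the strip R‴ and the «L» edition are the captain's (re-cut = re-split,
not a new route). The sibling columns (CovHg1201M19b OPEN,
CovHg1201M19P10 DRAFT) are separate routes sharing producers, caps-by-name and closers; the P-hull
(`EmeryBoxesHg1201PHull`) is NOT claimed.

CHEAPEST FALSIFIER. ALREADY RUN: w′(7/2) = the exact −b of the own-slot corner leg at (−27/50, 7/2,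
22/25) on the parent «GU7o2n22o25tpm27o50» = 0.4950122 ≤ 0.5084577
(sdp-2 kit j305091, cert/0 + verify_min ok ∧ equal, deposit
HOME/hubbard-cov-hg1201-sdp-2/legs-0828/Atop7o2-j305091/; pre-registered bands sdp-2
[0.490, 0.503] and captain [0.494, 0.504] both HIT) — decision node D1′ = ZONE (i′): proceed with
the pinned «L» reads. The NEXT cheapest check is the
p = 0.125 column's first pinned U-pair verdict (PIN-HG-U pinsolve j304245 + read, ≈ 12:45Z
2026-08-28): if the pinned le cross term at ΔU = 3/2 exceeds
≈ 0.4 there, the U-direction of BOTH @0 columns needs ≥ 3 bisection levels and the XL budget, not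
the mathematics, decides the schedule. The U = 0 sanity
(free value F′ = 0.42841 and exact one-body K′ = 0.51066 at the corner vs bar 0.5084577) is done
[float, captain tools/kscale.py].

NUMBERS. Box kinematic word (tree, `boxHg1201E_M19_stiffness_kinematic`): 0.5188344 (M = 128
half-bathtub majorant at the binding corner (−27/50, 22/25)); bar
0.98 × = 0.5084577 (D-0150 content-bar convention); kinematic cover thresholds of record n_k″ =
43/50 (M = 512 level 4077/8192, B ≤ 0.2938147291, reading
0.5078175, margin +0.0006403; M = 1024 confirms +0.0016475) and t* = −53/100 (M = 512 level
3823/8192, B ≤ 0.3010850667, reading 0.5064221 at 22/25,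
margin +0.0020356) ⇒ residual strip R‴ = [−27/50, −53/100] × [7/2, 44/5] × [43/50, 22/25]; exact
one-body sliver (where K > bar) = t′ ∈ [−0.54, ≈ −0.5366]
× n ∈ [≈ 0.8695, 0.88] [float]; binding corner: exact K′ = 0.51066 (bar 0.43 % under it), free F′ =
0.42841 (bar 18.7 % above it) — interim clause:
content = below 0.98 × the kinematic MAJORANT word; no suppression-below-free is claimed; PRINTED
vertex words: w′(7/2) = 0.4950122 (cap HF point
−4575891/5·10⁶ active, κ 0.0973, filling slope −0.2267660), w′(5) = 0.4885510 (cap −3123891/5·10⁶, κ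
0.0262, slope −0.2236391); coupling contents
0.0157 / 0.0221 (p = 0.125 column: 0.0152 / 0.0219 / 0.0713 at 7/2 / 5 / 44/5); a-priori energy
floor at t′ = −27/50: −124827703/5·10⁷ = −2.4965541
(`(16211390/10⁷)·(1 + |t′|)` shape).

DEFINITION REQUESTS. None: every notion is in tree (`ObsStiffnessSeqCeilingAt`,
`StiffnessBoxCeilingBelow`, `boxHg1201E_M19`, `InfVolFermionState`,
`IsGroundStateInSector`, `hubbardTorusTT'`, `oddMomentObsTT`, the target-slot «L» theorem, the M19
corner-strip closer and the t′-cut).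

Novelty: Searches (2026-08-28, inherited from the M19b / M19P10 siblings' birth records + tree): `lit search
--hybrid "upper bound superfluid stiffness kinetic energy f-sum rule Hubbard model" -n 6`
([corpus:book:lipparini2008 pp. 464–465], [corpus:book:griffin1995 p. 470], [corpus:book:lieb2005 p.
169]); `lit galaxy search "superfluid stiffness bound|upper bound on the superfluid" --star pdf -n
6` ([galaxy:pdf:5090094321543315700] Leggett's bound; [galaxy:pdf:4957438413378348860]
Saslow–Galli–Reatto cond-mat/0612464); tree: `rg StiffnessBoxCeiling lean/Summits` (material leaves:
La214 M2b, Hg1201 M19b/M19/M19P10, NdNiO₂), `ledger route show route-Ventures-CovHg1201M19b` /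
`route-Ventures-CovHg1201M19P10` (the two siblings).
Nearest prior art found: HazraVermaRanderia2019 (PRX 9, 031049: D_s ≤ kinetic bound, float
numerics), Leggett's variational upper bound [galaxy:pdf:5090094321543315700], the programme's own
CovHg1201M19b / CovHg1201M19P10 routes and La214 obligations (arXiv:2310.05844 for the SDP side).
Delta: the same certified sum-rule ceiling + lever-free target-slot transport, registered on the
optimal-doping column of the compound with the kinematic cover complete at birth and the corner word
printed before birth; a registration (crew rung route), not a mechanism.
Claimed grade: known  [refs: 2310.05844, book:lipparini2008, book:griffin1995, book:lieb2005, HazraVermaRanderia2019]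

Barriers (technique_class: sdp-lower-bound, sum-rule-moment-ceiling, box-transport): - technique_class: sdp-lower-bound, sum-rule-moment-ceiling, box-transport
- Literature.Barriers.HubbardSuperconductivity.StiffnessFloorInvisibleToSpectralMoments: conceded
and irrelevant — the route claims CEILINGS only, which is exactly what finitely many moments give.
- Literature.Barriers.HubbardSuperconductivity.EnergyWindowCeilingResolution: inside its class and
load-bearing — the ceiling resolves only down to the window slack; the bet is MEASURED on this very
column (c/K′ = 0.9694 at U = 7/2 with the HF point cap, needed ≤ 0.9957) and on the p = 0.125 column
(0.9707); what remains priced by this barrier is the le cross term of the pinned cell reads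
(PatchLeftEdgeM19's why-might-fail).
- Literature.Barriers.HubbardSuperconductivity.DegreeFourSosMissesSecondOrderPerturbation: inside
its class at U/t ≥ 7/2 — but after the kinematic cover NO suppression below the free value needs
certifying (bar 18.7 % above free at the corner); it bites only through the absolute window width,
i.e. through EnergyWindowCeilingResolution.
- Literature.Barriers.HubbardSuperconductivity.SignProblemNPHard: outside its class — exact rational
dual certificates, nothing sampled.
- Literature.Barriers.HubbardSuperconductivity.OrderParameterInvisibleToGroundStateConstraints:
conceded, irrelevant (no order-parameter floor claimed).
- Ladder ceiling (BC9): method_family=sdp sum-rule moment ceiling, box transport;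
ladder_ceiling=uncapped (the window slack shrinks with relaxation level and cap quality —

History (route lifecycle, newest last):
- 2026-09-03T05:49:51Z · DORMANT — reconciler: no traction for 5 d (last activity item-evidence-added at 2026-08-29T05:00:41Z); parked, not closed — `ledger route dormant route-Ventures-CovHg1201 (operator:999:215951)

sub-problem: CertifiedManyBodySolver · status: dormant · opened planner-hubbard-obs-lead-g21-0 2026-08-28T12:00:26Z · rev 0 · ledger route-Ventures-CovHg1201M19
GENERATED by the gate from the ledger (D-0016/17). Provers cite these decls: `theorem foo : Summit.Ventures.CertifiedManyBodySolver.Theses.CovHg1201M19.<Decl> := …` in Summits/Ventures/CertifiedManyBodySolver/Theorems/<Name>.lean.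
-/

namespace Summit.Ventures.CertifiedManyBodySolver.Theses.CovHg1201M19

open scoped BigOperators Topology Manifold Classical MeasureTheory ProbabilityTheory Matrix InnerProductSpace ComplexConjugate ContinuousMap
open Filter Set Function TopologicalSpace MeasureTheory

-- H21.Audit: Ventures rung route — no summit Statement decl; the expected conclusion is the closer leaf tagged below
attribute [summit_statement] _root_.Summit.Ventures.CertifiedManyBodySolver.Observables.Hg1201M19_StiffnessBoxCeiling

/-- item stmt-Ventures-27755 · crux · rank 2 · open · by planner
why it might fail: instrumental — a pinned U-cell read's le cross term exceeds the triangle allowance (√m_hub + √m_spoke)² at every affordable spacing (free le at ΔU = 3/2 on the p = 0.125 column: 0.101 vs 0.065), forcing bisections the XL queue cannot carry; the corner itself is printed (margin 0.0134).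
sources: HazraVermaRanderia2019, ScalapinoWhiteZhang1993, arXiv:2205.12325, arXiv:2310.05844, KomaTasaki1994
[crux] «PatchLeftEdgeM19» = the LEFT-EDGE BUNDLE of R‴: for every density n ∈ [43/50, 22/25], slot σ
∈ [−27/50, −53/100] and station U' ∈ [7/2, 44/5], every torus-limit sector ground state at the
Hamiltonian point (t′, U, n) = (−27/50, U', n) has D₄-averaged expectation of the target-slot f-sum
objective −X₀(σ, U') at least −0.5084577, i.e. the certified ceiling ⟨X₀(σ, U')⟩ ≤ 0.98 × the box
kinematic word (own-slot corner words w′(U') = the case σ = −27/50; intended witness: own-slot reads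
at vertices U' ∈ {7/2, 5, 44/5} on the EXT5-L⁺ parents «GU7o2n22o25tpm27o50» / «GU5…» / «GU44o5…»
(gen-1 W3 set, all deposited; A′7o2 j305091 = 0.4950122 and A′5 j305093 = 0.4885510 PRINTED, A′44o5
j305094 in flight) + PINNED-pair U-cell reads (hub = free certificate at the small-margin end, spoke
= pinned solve at the other end, captain ruling C-S1′; ONE bisection per failed cell per the
measured spacing law L ∝ ΔU^1.4), density interval [43/50, 22/25] by the families' own filling
multipliers (WN rows, zero extra solves); reader owner hubbard-cov-hg1201-box-1 lineage).
[difficulty: L] -/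
@[route_item "route-Ventures-CovHg1201M19"]
def PatchLeftEdgeM19 : Prop :=
  ∀ n ∈ Set.Icc (43 / 50 : ℝ) (22 / 25), ∀ σ ∈ Set.Icc (-27 / 50 : ℝ) (-53 / 100), ∀ U' ∈ Set.Icc (7 / 2 : ℝ) (44 / 5), ∀ (ω : Literature.MathematicalPhysics.QuantumLattice.InfVolFermionState 2) (Ls : ℕ → ℕ) (ψ : ∀ L, Literature.MathematicalPhysics.QuantumLattice.Fock (Literature.MathematicalPhysics.QuantumLattice.Orb (Literature.MathematicalPhysics.QuantumLattice.FermionTorus 2 L))), Filter.Tendsto Ls Filter.atTop Filter.atTop → (∀ j, Literature.MathematicalPhysics.QuantumLattice.IsGroundStateInSector (Literature.MathematicalPhysics.QuantumLattice.hubbardTorusTT' (Ls j) 1 (-27 / 50) U') (Literature.MathematicalPhysics.QuantumLattice.ThermodynamicLimit.rectN n (Ls j)) 0 (ψ (Ls j))) → (∀ j, star (ψ (Ls j)) ⬝ᵥ ψ (Ls j) = 1) → ω.IsTorusLimitOf ψ Ls → -(5084577 / 10000000 : ℝ) ≤ ((Finset.univ : Finset (DihedralGroup 4)).card : ℝ)⁻¹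 * ∑ g ∈ (Finset.univ : Finset (DihedralGroup 4)), (ω.expect (Literature.MathematicalPhysics.QuantumLattice.d4ShiftSet g 0 (Literature.Probability.LatticeModels.box 2 7)) (Literature.MathematicalPhysics.QuantumLattice.fermionEmbed (Literature.MathematicalPhysics.QuantumLattice.PolySite.d4Emb g 0 (Literature.Probability.LatticeModels.box 2 7)) (-Summit.Ventures.CertifiedManyBodySolver.Observables.oddMomentObsTT σ U' 0))).re

/-- item stmt-Ventures-27756 · crux · rank 3 · open · by planner
why it might fail: only through its s = −27/50 end, which IS PatchLeftEdgeM19's corner word (printed, margin 0.0134); independently only if the t′-pinned pair's pinning price π exceeds ≈ 0.015 at Δt′ ≤ 1/50 (La214's first two pinned solves: π = 0.0003 / 0.0005 at Δt′ = 0.1).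
sources: HazraVermaRanderia2019, arXiv:2310.05844, KomaTasaki1994
[crux] «PatchBottomM19» = the BOTTOM BUNDLE of R‴: for every n ∈ [43/50, 22/25], slot σ ∈ [−27/50,
−53/100] and source s ∈ [−27/50, σ], every torus-limit sector ground state at (s, 7/2, n) has
D₄-averaged expectation of −X₀(σ, 7/2) at least −0.5084577 (σ-span 1/100 after the t′-kinematic cut;
vertices = the corner parent shared with PatchLeftEdgeM19 + ONE spoke at (7/2, −53/100, 22/25) or
(7/2, −13/25, 22/25) pinned to the corner certificate (t′-pinned pair, R = 2 856 axis-dependent eom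
rows; free le part at Δt′ = 1/50 on the p = 0.125 column = 0.0021), read on the sub-cell; at the
inner edge s = −53/100 nothing is owed (all slots σ ≥ −53/100 are state-free)). [difficulty: M] -/
@[route_item "route-Ventures-CovHg1201M19"]
def PatchBottomM19 : Prop :=
  ∀ n ∈ Set.Icc (43 / 50 : ℝ) (22 / 25), ∀ σ ∈ Set.Icc (-27 / 50 : ℝ) (-53 / 100), ∀ s ∈ Set.Icc (-27 / 50 : ℝ) σ, ∀ (ω : Literature.MathematicalPhysics.QuantumLattice.InfVolFermionState 2) (Ls : ℕ → ℕ) (ψ : ∀ L, Literature.MathematicalPhysics.QuantumLattice.Fock (Literature.MathematicalPhysics.QuantumLattice.Orb (Literature.MathematicalPhysics.QuantumLattice.FermionTorus 2 L))), Filter.Tendsto Ls Filter.atTop Filter.atTop → (∀ j, Literature.MathematicalPhysics.QuantumLattice.IsGroundStateInSector (Literature.MathematicalPhysics.QuantumLattice.hubbardTorusTT' (Ls j) 1 s (7 / 2)) (Literature.MathematicalPhysics.QuantumLattice.ThermodynamicLimit.rectN n (Ls j)) 0 (ψ (Ls j))) → (∀ j, star (ψ (Ls j)) ⬝ᵥ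 ψ (Ls j) = 1) → ω.IsTorusLimitOf ψ Ls → -(5084577 / 10000000 : ℝ) ≤ ((Finset.univ : Finset (DihedralGroup 4)).card : ℝ)⁻¹ * ∑ g ∈ (Finset.univ : Finset (DihedralGroup 4)), (ω.expect (Literature.MathematicalPhysics.QuantumLattice.d4ShiftSet g 0 (Literature.Probability.LatticeModels.box 2 7)) (Literature.MathematicalPhysics.QuantumLattice.fermionEmbed (Literature.MathematicalPhysics.QuantumLattice.PolySite.d4Emb g 0 (Literature.Probability.LatticeModels.box 2 7)) (-Summit.Ventures.CertifiedManyBodySolver.Observables.oddMomentObsTT σ (7 / 2) 0))).re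

/-- item stmt-Ventures-27757 · assembly · rank 1 · closed · proved by Summit.Ventures.CertifiedManyBodySolver.Theorems.covHg1201M19Assembly_proof (prover) · by planner
sources: ScalapinoWhiteZhang1993, KomaTasaki1994
[assembly] PatchLeftEdgeM19 → PatchBottomM19 → the rung leaf Hg1201M19_StiffnessBoxCeiling -/
@[route_item "route-Ventures-CovHg1201M19"]
def Assembly : Prop :=
  Summit.Ventures.CertifiedManyBodySolver.Theses.CovHg1201M19.PatchLeftEdgeM19 → Summit.Ventures.CertifiedManyBodySolver.Theses.CovHg1201M19.PatchBottomM19 → Summit.Ventures.CertifiedManyBodySolver.Observables.Hg1201M19_StiffnessBoxCeiling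

-- `Assembly` holds: proved by `Summit.Ventures.CertifiedManyBodySolver.Theorems.covHg1201M19Assembly_proof` (its module imports this route file, so no `_holds` link can be stated here).

/-! D-0027 §2.1 — DECIDING THEOREM (planner-authored via `route open/edit --closes-file`; by planner-hubbard-obs-lead-g21-0 2026-08-28T12:00:26Z):
its hypotheses are this route's items and its conclusion the registered leaf `Summit.Ventures.CertifiedManyBodySolver.Observables.Hg1201M19_StiffnessBoxCeiling` (rung MO-S2, D-0061) (glue_lint), and it elaborates with this file. -/

@[closes "route-Ventures-CovHg1201M19"] theorem closes (h₁ : PatchLeftEdgeM19) (h₂ : PatchBottomM19) :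
    Summit.Ventures.CertifiedManyBodySolver.Observables.Hg1201M19_StiffnessBoxCeiling :=
  Summit.Ventures.CertifiedManyBodySolver.Downfold.Hg1201M19_StiffnessBoxCeiling_of_cornerStrip le_rfl
    fun tp htp U hU n hn => by
      rcases le_or_gt (-53 / 100 : ℝ) tp with ht | ht
      · exact Summit.Ventures.CertifiedManyBodySolver.Downfold.hg1201M19_bar_kinematic_of_m53o100_le_tp
          ⟨ht, by linarith [htp.2]⟩ (by linarith [hn.1]) hn.2
      · exact Summit.Ventures.CertifiedManyBodySolver.Observables.ObsStiffnessSeqCeilingAt_on_box_of_bottomEdge_and_leftEdge_targetSlot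
          (p := -27 / 50) (q := -53 / 100) (UA := 7 / 2) (Umax := 44 / 5) (n := n)
          (by norm_num) (by norm_num) (by norm_num) (by linarith [hn.1]) (by linarith [hn.2])
          (fun _ _ => -(5084577 / 10000000 : ℝ)) (fun _ _ => -(5084577 / 10000000 : ℝ)) (5084577 / 10000000)
          (fun σ hσ s hs => h₂ n hn σ hσ s hs) (fun σ _ s _ => by norm_num) (fun σ hσ U' hU' => h₁ n hn σ hσ U' hU')
          (fun σ _ U' _ => by norm_num) tp ⟨htp.1, ht.le⟩ U hU

end Summit.Ventures.CertifiedManyBodySolver.Theses.CovHg1201M19
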